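import Summits.QuantumFields.YangMills.Theorems.UnitScaleTiltProp7LemmaHCurvedDirichletCount
import Summits.QuantumFields.YangMills.Theorems.UnitScaleTiltProp7CombLadderCountExact
import HarnessLib

/-!
# Route `UnitScaleTilt`, crux K1 «MinimiserStabilityRegPr» (stmt-QuantumFields-19200), route-R E′ path (α′), S3 K-form engine, row (H) ∕ (R4′) — FILE 9k″ (T³ letters):
# THE DIRICHLET GROUP OF LEMMA-H-CURVED, COUNTED WITH EXACT MULTIPLICITIES — ✓p675776 §1 `sum_ite_comm_loopT_sq_le_canonical` with ✓ `sum_box_comm_loop_sq_le_exact`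
# (✓p678641) in place of ✓ `sum_box_comm_loop_sq_le`: the loop commutators of the Dirichlet group on the support of a local axial model, `Σ_z [N z] Σ_μ (N_m(h(z−e_μ,μ))² +
# N_m(h(z,μ))²)`, are bounded by `2·Σ_μ Σ_(i<|t_μ|) Σ_(q∈[−R,R]^d) (W⁺_(μ,i)(q)·f_μ(q,(t_(μ,i),+)) + W⁻_(μ,i)(q)·f_μ(q,(t_(μ,i),−)))` with the CANONICAL letter
# `f_μ(q,l) = ‖[𝒱^(c₀)_q(l μ l̄ μ̄), R(𝒱^(c₀)(Γ_(0,q))⁻¹)m]‖²` and the EXACT weights `W^±_(μ,i)(q) = Σ_(v ∈ box, P^±_(D_(μ,i),t_(μ,i))(v,q)) |B_μ(v)|` of ✓ `Prop7CombLadderCountExact`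
# (trunk-supported filtered box sums; `D_(μ,i) = {μ} ∪ s_μ ∪ t_μ[0..i)`, `|B_μ(v)| = Σ_(κ∈t_μ)|v κ|`) — no `(|t_μ|R)·(2R+1)^(|t_μ|−i)` sup

Cell `ym3-torus`, width seat `ym3-torus-px9` (gen 4); ★ym-ust-19200-p1 g16 NAMER WORD 4 (1) «px9: F-H9h″ EXACT-MULT GO … then the `_exact` re-cut (routeR-w1's letters; routeR-w1 holds
the `_pt` chain, you hold the count)»; routeR-w1 g6 2026-08-28 23:33Z «your `_exact` re-cut replaces `sum_box_comm_loop_sq_le`'s RHS only».  THEOREMS ONLY (0 `def`, 0 `sorry`);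
`--supports stmt-QuantumFields-19200 --as helper`, count-neutral.  YM₃ on T³ is a RUNG of the ladder (R3) — not d = 4, not infinite volume, not a mass gap, not the Clay problem;
nothing here claims a stub, the crux or any summit statement.

WHAT IS PROVED (ns `…Theorems.Prop7LemmaHCurvedDirichletCountExact`; any torus `Site P j`, bi-contractive `V`, base `c₀`, datum `m`, support `N`, window row `hbox` and comb-order
splits `(finRange d).reverse = s_μ ++ μ :: t_μ` displayed VERBATIM as in ✓p675776 §1).
* ★★★ `sum_ite_comm_loopT_sq_le_canonical_exact` — the CHAIN-AGNOSTIC Dirichlet brick: same LHS and hypotheses as ✓ `sum_ite_comm_loopT_sq_le_canonical`, RHS with exact weights.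
  Every (α)-letter door downstream (✓p675776 §2 `lemmaH_curved_comb_avg_count` → ✓p676499 windowed → ✓p676852 transported, and routeR-w1's `_pt` chain ✓p677940 …) calls the
  §1 brick once per (offset, block); swapping this theorem in is their `_exact` re-cut.
HONEST SCOPE.  Bookkeeping (✓ `sum_ite_comm_loopT_sq_le_box` ∘ ✓ `sum_box_comm_loop_sq_le_exact` per direction); no estimate of the letters, no booking against `K_gauge`.

References: T. Bałaban, CMP 98 (1985) 17–51 [Balaban1985Averaging] ((9) pp.18–19, (19)–(20) p.21, p.24); CMP 102 (1985) 255–275 [Balaban1985UV3] ((27) p.263).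
-/

set_option autoImplicit false

noncomputable section

open scoped BigOperators

namespace Summit.QuantumFields.YangMills.Theorems.Prop7LemmaHCurvedDirichletCountExact

open Literature.MathematicalPhysics.QuantumFieldTheory.Balaban1983to89
open B7Prop1Explicit (Letter e seg treeWord hol)
open B10Eq27AxialLog (contour27)
open B9Eq39Adjoint (R)
open B9TorusCalculus (torusT)
open B10Eq27TorusAxialLog (holT contourT rel pull)
open Summit.QuantumFields.YangMills.Theorems.Prop7CombLadder (bicontr_pull)
open Summit.QuantumFields.YangMills.Theorems.Prop7LemmaHCurvedDirichletCount (sum_ite_comm_loopT_sq_le_box)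
open Summit.QuantumFields.YangMills.Theorems.Prop7CombLadderCountExact (sum_box_comm_loop_sq_le_exact)

variable {𝔸 : Type*} [NormedRing 𝔸] [NormOneClass 𝔸] {P : Params} {j : ℕ} (V : GaugeField P j 𝔸ˣ)

/-- ★★★ **THE DIRICHLET GROUP COUNTED WITH EXACT MULTIPLICITIES** (drop-in for ✓ `Prop7LemmaHCurvedDirichletCount.sum_ite_comm_loopT_sq_le_canonical`): on the support `N` of a
local axial model based at `c₀`, inside the window `hbox`,
`Σ_z [N z] Σ_μ (N_m(h(z−e_μ,μ))² + N_m(h(z,μ))²) ≤ 2·Σ_μ Σ_(i<|t_μ|) Σ_(q∈[−R,R]^d) (W⁺_(μ,i)(q)·f_μ(q,(t_(μ,i),+)) + W⁻_(μ,i)(q)·f_μ(q,(t_(μ,i),−)))`,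
`f_μ(q,l) = ‖[𝒱^(c₀)_q(l μ l̄ μ̄), R(𝒱^(c₀)(Γ_(0,q))⁻¹)m]‖²` (`𝒱^(c₀) = pull V c₀`), `W^±_(μ,i)(q) = Σ_(v ∈ box, P^±(v,q)) |B_μ(v)|` the EXACT trunk-supported weights of
✓ `sum_box_comm_loop_sq_le_exact` (`D_(μ,i) = (t_μ.take i).foldl insert (insert μ s_μ.toFinset)`). [cite: Balaban1985UV3, (27) p.263] [cite: Balaban1985Averaging, (9) pp.18–19, (19)–(20) p.21, p.24] -/
theorem sum_ite_comm_loopT_sq_le_canonical_exact (hV : ∀ b : PBond P j, ‖(V b : 𝔸)‖ ≤ 1 ∧ ‖(((V b)⁻¹ : 𝔸ˣ) : 𝔸)‖ ≤ 1) (c₀ : Site P j) (m : 𝔸)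
    (N : Site P j → Prop) [DecidablePred N] (R₀ : ℕ)
    (hbox : ∀ z, N z → ∀ (μ : Fin P.d) (ν : Fin P.d), |rel c₀ z ν| ≤ (R₀ : ℤ) ∧ |rel c₀ ((torusT P j μ).symm z) ν| ≤ (R₀ : ℤ))
    (s t : Fin P.d → List (Fin P.d)) (hsplit : ∀ μ, (List.finRange P.d).reverse = s μ ++ μ :: t μ) (hs : ∀ μ, μ ∉ s μ) (ht : ∀ μ, μ ∉ t μ) :
    ∑ z : Site P j, (if N z then ∑ μ : Fin P.d,
        (‖((holT V c₀ (contourT c₀ ⟨(torusT P j μ).symm z, μ⟩) : 𝔸ˣ) : 𝔸) * m - m * ((holT V c₀ (contourT c₀ ⟨(torusT P j μ).symm z, μ⟩) : 𝔸ˣ) : 𝔸)‖ ^ 2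
          + ‖((holT V c₀ (contourT c₀ ⟨z, μ⟩) : 𝔸ˣ) : 𝔸) * m - m * ((holT V c₀ (contourT c₀ ⟨z, μ⟩) : 𝔸ˣ) : 𝔸)‖ ^ 2) else 0)
      ≤ 2 * ∑ μ : Fin P.d, ∑ i ∈ Finset.range (t μ).length, ∑ q ∈ Fintype.piFinset (fun _ : Fin P.d => Finset.Icc (-(R₀ : ℤ)) (R₀ : ℤ)),
          ((∑ v ∈ (Fintype.piFinset (fun _ : Fin P.d => Finset.Icc (-(R₀ : ℤ)) (R₀ : ℤ))).filter
                (fun v => (∀ ν ∈ ((t μ).take i).foldl (fun S ν => insert ν S) (insert μ (s μ).toFinset), q ν = v ν)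
                  ∧ (∀ ν, ν ∉ ((t μ).take i).foldl (fun S ν => insert ν S) (insert μ (s μ).toFinset) → ν ≠ (t μ).getD i μ → q ν = 0)
                  ∧ 0 ≤ q ((t μ).getD i μ) ∧ q ((t μ).getD i μ) < v ((t μ).getD i μ)), ((((t μ).flatMap (fun κ => seg κ (v κ))).length : ℕ) : ℝ))
              * ‖((hol (pull V c₀) q [((t μ).getD i μ, true), (μ, true), Letter.rev ((t μ).getD i μ, true), (μ, false)] : 𝔸ˣ) : 𝔸) * R (hol (pull V c₀) 0 (treeWord q))⁻¹ m
                  - R (hol (pull V c₀) 0 (treeWord q))⁻¹ m * ((hol (pull V c₀) q [((t μ).getD i μ, true), (μ, true), Letter.rev ((t μ).getD i μ, true), (μ, false)] : 𝔸ˣ) : 𝔸)‖ ^ 2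
            + (∑ v ∈ (Fintype.piFinset (fun _ : Fin P.d => Finset.Icc (-(R₀ : ℤ)) (R₀ : ℤ))).filter
                (fun v => (∀ ν ∈ ((t μ).take i).foldl (fun S ν => insert ν S) (insert μ (s μ).toFinset), q ν = v ν)
                  ∧ (∀ ν, ν ∉ ((t μ).take i).foldl (fun S ν => insert ν S) (insert μ (s μ).toFinset) → ν ≠ (t μ).getD i μ → q ν = 0)
                  ∧ v ((t μ).getD i μ) < q ((t μ).getD i μ) ∧ q ((t μ).getD i μ) ≤ 0), ((((t μ).flatMap (fun κ => seg κ (v κ))).length : ℕ) : ℝ))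
              * ‖((hol (pull V c₀) q [((t μ).getD i μ, false), (μ, true), Letter.rev ((t μ).getD i μ, false), (μ, false)] : 𝔸ˣ) : 𝔸) * R (hol (pull V c₀) 0 (treeWord q))⁻¹ m
                  - R (hol (pull V c₀) 0 (treeWord q))⁻¹ m * ((hol (pull V c₀) q [((t μ).getD i μ, false), (μ, true), Letter.rev ((t μ).getD i μ, false), (μ, false)] : 𝔸ˣ) : 𝔸)‖ ^ 2) :=
  (sum_ite_comm_loopT_sq_le_box V c₀ m N R₀ hbox).trans (mul_le_mul_of_nonneg_left
    (Finset.sum_le_sum fun μ _ => sum_box_comm_loop_sq_le_exact (pull V c₀) (bicontr_pull V hV c₀) R₀ μ (hsplit μ) (hs μ) (ht μ) m) (by norm_num))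

end Summit.QuantumFields.YangMills.Theorems.Prop7LemmaHCurvedDirichletCountExact

end
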